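import Summits.QuantumFields.YangMills.Theorems.BalabanUVNodesN15BackgroundV1ByName
import Summits.QuantumFields.YangMills.Theorems.BalabanUVNodesN15BackgroundAveragingWords
import HarnessLib

/-!
# Route «BalabanUVNodes» (cluster K4 «SpineRates»), Track-A DAG node N15 = spine estimate NE2, BACKGROUND LAYER — THE (3.42) η-RATE ENTRIES WITH THE
# (3.60)-SHAPED FULL PERTURBATION `V′(A) = V′₁(A) − W(A)` LIVE: the print's `V′₁(A)` of (3.52) on the forward∕backward stack PLUS ANY block-local zeroth-order
# species `W` (the averaging words `F₂*aQ + Q*aF₂ + F₂*aF₂` of (3.60) are the intended inhabitant), under the guard, for any kernel family that evaluates to them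

Cell `pub-ymgap`, seat `pub-ymgap-dag-n15-c` (generation g4; R134 ACCELERATION SEAT, strategy s1 «background-layer OPERATOR ingredient»; HUMAN RULING D-0062; chair
R424 venue).  `bears_on: R4∕N15`.  Filed `--supports stmt-QuantumFields-19908 --as helper` (K3′; helper).  Imports BY NAME, nothing in the tree modified: this seat's
V2 `…N15BackgroundV1ByName` (`gV1c35`, `le_gV1c35`, V1b `v1Bg`∕`v1coefC`∕`v1coefA`∕`v1avg`∕`v1_letters_of_reg335`, V0 `hasMaj_entries_of_letters`∕
`entryMajorant_le_etaRateShape`, M1 `unstackM`, n15-b B1a∕B3 `bgPropV`∕`bgSourceV`∕`bgDerivedV`∕`stack`∕`projO`∕`bgConst`∕`bgConst1`, g0 `opFamily`∕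
`etaRateIneq342_of_hasMaj`) and (V5) `…N15BackgroundAveragingWords` (`hasMaj_sub_word`, `hasMaj_idef_sub_word`).

THE POINT.  [Balaban1985BackgroundPropagators] (3.60) p. 402 defines the background perturbation as `V′(A) = V′₁(A) − [F′₂*(A)aQ′(U) + Q′*(U)aF′₂(A) + F′₂*(A)aF′₂(A)]`;
every readout of the lineage so far (B4∕C2∕M3∕G2∕V2∕(V4)) carried `V′₁(A)` only.  The bracket is a BLOCK-LOCAL ZEROTH-ORDER operator on `λ` ((3.59), (3.61): size
`O(1)α₁·a`), so on the stacked `U ≡ 1` layer it acts through the `none` component: `V̂ = V̂₁ − W∘pr_none`, and by (V5)'s `hasMaj_sub_word`∕`hasMaj_idef_sub_word` its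
three B1a letters are those of `V̂₁` (V1b's `v1_letters_of_reg335`) plus those of `W`.  THIS FILE: for ANY block-local `W` (coarse) ∕ `W′` (fine) with the species
letters `W, W′ ≤ diagK (c_W·c₃₅Mα₀)`, `𝔇(W′, W) ≤ diagK (c_W·c₃₅Mα₀·θ)` — the (3.59)-shape sup letter and a two-spacing fit letter (NOT PRINTED) — the FULL perturbation
has letters `(vWR, vWR, vWR·θ)` with `vWR ≤ gVWc35·a₀` under the guard (`gVWc35 = gV1c35 + c_W·c₃₅`), hence ALL FOUR (3.42) entry defects of the constructed pair
`≤ {bgConst, bgConst1}(β, c_r, m₀, gVWc35, a₀)·θ·e^{−(δ−σ)d}` and `EtaRateIneq342` at the configuration — for ANY carrier `B` and kernel family whose four entries AT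
that configuration are `vWEntries` (so the triple carrier, the gauge carrier and the realised vector piece all read it by `rfl`).  (V5)'s `avgWord` with
`hasMaj_avgWord`∕`hasMaj_idef_avgWord` is the intended `W`; the node theorems are the sequel.

CONTENTS ([folklore] bookkeeping; 5 defs).  §1 `gVWc35`, `le_gVWc35`, `vWR` (`vWR_nonneg_le`), `vWPert C A W := unstackM C A − W∘pr_none`; **`vW_letters_of_reg335`**.
§2 `vWEntries` (the four η-difference operators at a triple `T = (A⁺, A⁻, W_div)` and a word pair `(W, W′)`), `vWOps4 tri Wc Wf` (the kernel-family ops for a carrier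
whose configurations `U` give a triple `tri U` and words `Wc U`, `Wf U`; `vWOps4_apply`); **`hasMaj_vWEntries`** (the four entries under the guard);
**`etaRateIneq342_vWEntries`** (any `B`, any family `T4` with `T4 n U = vWEntries … n`: `EtaRateIneq342` at `U`, `B₀ = bgConst + bgConst1` at `gVWc35`, `δ₀ = δ − σ`).

HONEST FRAMING ∕ LIMITS.  SHAPES of (3.52) + (3.60) in the `U ≡ 1` background; `W` and its two letters are DISPLAYED species data (the print's `F′₂ⱼ(A)` of
(3.55)–(3.58) is NOT constructed; the fit letter is NOT PRINTED); the three `V′₁` fields transported by fibrewise means (linearised (C3)); `𝔤 ↦ 𝔄` with coordinates;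
the `U ≡ 1` layer on `J ⊕ J` DISPLAYED; crude constants; nothing about Bałaban's `G(U)` asserted.  NE2⁺ NOT PRINTED, NOT proved; count-neutral (typed 28∕28; nothing
discharged); N15 NOT discharged; one finite lattice at fixed ε — NOT infinite volume, NOT OS on ℝ⁴, NOT a mass gap, NOT Clay.
-/

noncomputable section

open scoped BigOperators

namespace Summit.QuantumFields.YangMills.BalabanUVNodes.N15.BackgroundLayer

open Literature.MathematicalPhysics.QuantumFieldTheory.Balaban1983to89
open Literature.MathematicalPhysics.QuantumFieldTheory.Balaban1983to89.B11SectG (BlockNorm HasMaj RowSum)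
open Literature.MathematicalPhysics.QuantumFieldTheory.Balaban1983to89.T4EtaRate (EtaRateIneq342 rateFactor)
open Literature.MathematicalPhysics.QuantumFieldTheory.Balaban1983to89.T4EtaRateDefect (idef rateWeight)
open Literature.MathematicalPhysics.QuantumFieldTheory.Balaban1983to89.T4EtaRateCoeffDefect (pull diagK diagK_mono)
open Literature.MathematicalPhysics.QuantumFieldTheory.Balaban1983to89.B6RandomWalk (Triangle254)
open Summit.QuantumFields.YangMills.BalabanUVNodes.N15.OperatorReadout (opGeo opFamily opGeo_len etaRateIneq342_of_hasMaj)
open Summit.QuantumFields.YangMills.BalabanUVNodes.N15.MatrixSpecies (liftMap liftBlk basisConst basisConst_nonneg)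

/-! ## §1 The letters of the full perturbation `V̂₁ − W∘pr_none` under the guard -/

section Letters

variable {X X' J ι : Type} [Fintype X] [Fintype X'] [Fintype J] [Fintype ι] [DecidableEq X] [DecidableEq ι] {𝔄 : Type} [NormedRing 𝔄]
  [NormedAlgebra ℝ 𝔄] [CompleteSpace 𝔄] (e : 𝔄 ≃L[ℝ] (ι → ℝ)) {g : B6.Geometry} (blk : X → g.Site) (π : X' → X)

/-- THE EFFECTIVE (3.35) CONSTANT of the full perturbation: `gV1c35 + c_W·c₃₅` (so its letter `vWR ≤ gVWc35·a₀` under the guard). [folklore] -/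
def gVWc35 (J : Type) [Fintype J] (κ c35 cW : ℝ) : ℝ := gV1c35 J κ c35 + cW * c35

omit [Fintype X] [Fintype X'] [DecidableEq X] in
/-- `c₃₅ ≤ gVWc35`, `0 < gVWc35`, `gV1c35 ≤ gVWc35` for `c₃₅ > 0`, `κ, c_W ≥ 0`. [folklore] -/
theorem le_gVWc35 {κ c35 cW : ℝ} (hκ : 0 ≤ κ) (hc35 : 0 < c35) (hcW : 0 ≤ cW) :
    c35 ≤ gVWc35 J κ c35 cW ∧ 0 < gVWc35 J κ c35 cW ∧ gV1c35 J κ c35 ≤ gVWc35 J κ c35 cW := by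
  obtain ⟨h1, h2⟩ := le_gV1c35 (J := J) hκ hc35
  have h3 : 0 ≤ cW * c35 := mul_nonneg hcW hc35.le
  unfold gVWc35
  exact ⟨by linarith, by linarith, by linarith⟩

/-- THE LETTER of the full perturbation: V1b's stacked max-row-sum letter `16e(1+|J|)κ·c₃₅Mα₀·(1+|J ⊕ J|)` plus the species letter `c_W·c₃₅Mα₀`. [folklore] -/
def vWR (J : Type) [Fintype J] (κ c35 M α₀ cW : ℝ) : ℝ :=
  16 * Real.exp 1 * (1 + Fintype.card J) * κ * (c35 * M * α₀) * (1 + Fintype.card (J ⊕ J)) + cW * (c35 * M * α₀)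

omit [Fintype X] [Fintype X'] [DecidableEq X] in
/-- `0 ≤ vWR ≤ gVWc35·a₀` under the guard `M ≥ 1`, `α₀ > 0`, `Mα₀ ≤ a₀` (`κ, c_W ≥ 0`, `c₃₅ > 0`). [folklore] -/
theorem vWR_nonneg_le {κ c35 M α₀ a₀ cW : ℝ} (hκ : 0 ≤ κ) (hc35 : 0 < c35) (hcW : 0 ≤ cW) (hM : 1 ≤ M) (hα₀ : 0 < α₀) (hMα : M * α₀ ≤ a₀) :
    0 ≤ vWR J κ c35 M α₀ cW ∧ vWR J κ c35 M α₀ cW ≤ gVWc35 J κ c35 cW * a₀ := by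
  have hM0 : 0 ≤ M := zero_le_one.trans hM
  have hr0 : 0 ≤ c35 * M * α₀ := by positivity
  have hra : c35 * M * α₀ ≤ c35 * a₀ := by rw [mul_assoc]; exact mul_le_mul_of_nonneg_left hMα hc35.le
  have he : 0 ≤ Real.exp 1 := Real.exp_nonneg 1
  have hJ : (0 : ℝ) ≤ 1 + Fintype.card J := by positivity
  have hJJ : (0 : ℝ) ≤ 1 + Fintype.card (J ⊕ J) := by positivity
  have hP : 0 ≤ 16 * Real.exp 1 * (1 + Fintype.card J) * κ * (1 + Fintype.card (J ⊕ J)) := by positivity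
  refine ⟨by unfold vWR; positivity, ?_⟩
  calc vWR J κ c35 M α₀ cW
      = (16 * Real.exp 1 * (1 + Fintype.card J) * κ * (1 + Fintype.card (J ⊕ J))) * (c35 * M * α₀) + cW * (c35 * M * α₀) := by unfold vWR; ring
    _ ≤ (16 * Real.exp 1 * (1 + Fintype.card J) * κ * (1 + Fintype.card (J ⊕ J))) * (c35 * a₀) + cW * (c35 * a₀) :=
        add_le_add (mul_le_mul_of_nonneg_left hra hP) (mul_le_mul_of_nonneg_left hra hcW)
    _ ≤ (16 * Real.exp 1 * (1 + Fintype.card J) * (1 + Fintype.card (J ⊕ J)) * (1 + κ)) * (c35 * a₀) + cW * (c35 * a₀) := by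
        have h0 : 0 ≤ c35 * a₀ := hr0.trans hra
        nlinarith [mul_nonneg (mul_nonneg (mul_nonneg (mul_nonneg (by norm_num : (0:ℝ) ≤ 16) he) hJ) hJJ) h0]
    _ = gVWc35 J κ c35 cW * a₀ := by unfold gVWc35 gV1c35; ring

/-- THE FULL PERTURBATION of the stacked layer: M1's unstacked matrix perturbation MINUS a block-local word on the `none` component, `V̂ = V̂₁ − W∘pr_none` — the
(3.60) shape `V′ = V′₁ − [F₂*aQ + Q*aF₂ + F₂*aF₂]`. [cite: Balaban1985BackgroundPropagators, (3.60) p.402 (shape)] -/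
def vWPert (C : X → Matrix ι ι ℝ) (A : J → X → Matrix ι ι ℝ) (W : (X × ι → ℝ) →ₗ[ℝ] (X × ι → ℝ)) : ((X × ι) × Option J → ℝ) →ₗ[ℝ] (X × ι → ℝ) :=
  unstackM C A - W ∘ₗ projO none

/-- **THE THREE PERTURBATION LETTERS OF THE FULL `V′ = V′₁ − W` FROM (3.35) AND THE SPECIES LETTERS.**  Spacings `0 ≤ η′ ≤ η ≤ 1`, `η ≤ θ`; guard `c₃₅ > 0`, `M ≥ 1`,
`α₀ > 0`, `M·α₀ ≤ a₀`, `2c₃₅a₀ ≤ 1`; `(v1Bg 𝔄 J π M θ).Reg335 c₃₅ α₀ U′`; species letters `W, W′ ≤ diagK (c_W·c₃₅Mα₀)`, `𝔇(W′, W) ≤ diagK (c_W·c₃₅Mα₀·θ)` (`c_W ≥ 0`).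
Then the coarse `vWPert` (V′₁ coefficients at `η` and the averaged fields, word `W`) and the fine one (at `η′`, `U′`, `W′`) have majorants `diagK vWR` and diagonal η-defect
`diagK (vWR·θ)`, `0 ≤ vWR ≤ gVWc35·a₀`. [cite: Balaban1985BackgroundPropagators, (3.35) p.396, (3.52) p.400, (3.59)–(3.61) p.402 (shapes)] -/
theorem vW_letters_of_reg335 {η η' θ c35 a₀ M α₀ cW : ℝ} (hη' : 0 ≤ η') (hη'η : η' ≤ η) (hη1 : η ≤ 1) (hηθ : η ≤ θ) (hc35 : 0 < c35)
    (hM : 1 ≤ M) (hα₀ : 0 < α₀) (hMα : M * α₀ ≤ a₀) (ha₀1 : 2 * (c35 * a₀) ≤ 1) (hcW : 0 ≤ cW)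
    {U' : (J → X' → 𝔄) × (J → X' → 𝔄) × (X' → 𝔄)} (hreg : (v1Bg 𝔄 J π M θ).Reg335 c35 α₀ U')
    {W : (X × ι → ℝ) →ₗ[ℝ] (X × ι → ℝ)} {W' : (X' × ι → ℝ) →ₗ[ℝ] (X' × ι → ℝ)}
    (hW : HasMaj (BlockNorm.ofBlocks g (liftBlk blk ι)) (BlockNorm.ofBlocks g (liftBlk blk ι)) W (diagK fun _ => cW * (c35 * M * α₀)))
    (hW' : HasMaj (BlockNorm.ofBlocks g (liftBlk (blk ∘ π) ι)) (BlockNorm.ofBlocks g (liftBlk (blk ∘ π) ι)) W' (diagK fun _ => cW * (c35 * M * α₀)))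
    (hDW : HasMaj (BlockNorm.ofBlocks g (liftBlk blk ι)) (BlockNorm.ofBlocks g (liftBlk (blk ∘ π) ι))
      (idef (pull (liftMap π ι)) (pull (liftMap π ι)) W' W) (diagK fun _ => cW * (c35 * M * α₀) * θ)) :
    0 ≤ vWR J (basisConst e) c35 M α₀ cW ∧ vWR J (basisConst e) c35 M α₀ cW ≤ gVWc35 J (basisConst e) c35 cW * a₀ ∧
      HasMaj (BlockNorm.ofBlocks g (blkPair (liftBlk blk ι))) (BlockNorm.ofBlocks g (liftBlk blk ι))
        (vWPert (v1coefC e η (v1avg 𝔄 J π U')) (v1coefA e η (v1avg 𝔄 J π U')) W) (diagK fun _ => vWR J (basisConst e) c35 M α₀ cW) ∧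
      HasMaj (BlockNorm.ofBlocks g (blkPair (liftBlk (blk ∘ π) ι))) (BlockNorm.ofBlocks g (liftBlk (blk ∘ π) ι))
        (vWPert (v1coefC e η' U') (v1coefA e η' U') W') (diagK fun _ => vWR J (basisConst e) c35 M α₀ cW) ∧
      HasMaj (BlockNorm.ofBlocks g (blkPair (liftBlk blk ι))) (BlockNorm.ofBlocks g (liftBlk (blk ∘ π) ι))
        (idef (pull (liftPair (liftMap π ι))) (pull (liftMap π ι)) (vWPert (v1coefC e η' U') (v1coefA e η' U') W')
          (vWPert (v1coefC e η (v1avg 𝔄 J π U')) (v1coefA e η (v1avg 𝔄 J π U')) W))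
        (diagK fun _ => vWR J (basisConst e) c35 M α₀ cW * θ) := by
  obtain ⟨_, _, hV, hV', hDV⟩ := v1_letters_of_reg335 e (g := g) blk π hη' hη'η hη1 hηθ hc35 hM hα₀ hMα ha₀1 hreg
  obtain ⟨hR0, hRa⟩ := vWR_nonneg_le (J := J) (basisConst_nonneg e) hc35 hcW hM hα₀ hMα
  have hM0 : 0 ≤ M := zero_le_one.trans hM
  have hr0 : 0 ≤ cW * (c35 * M * α₀) := by positivity
  have hθ0 : 0 ≤ θ := (hη'.trans hη'η).trans hηθ
  have hRθ : 16 * Real.exp 1 * (1 + Fintype.card J) * basisConst e * (c35 * M * α₀) * θ * (1 + Fintype.card (J ⊕ J)) =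
      16 * Real.exp 1 * (1 + Fintype.card J) * basisConst e * (c35 * M * α₀) * (1 + Fintype.card (J ⊕ J)) * θ := by ring
  rw [hRθ] at hDV
  refine ⟨hR0, hRa, hasMaj_sub_word (liftBlk blk ι) hr0 hV hW, hasMaj_sub_word (liftBlk (blk ∘ π) ι) hr0 hV' hW', ?_⟩
  refine (hasMaj_idef_sub_word (liftBlk blk ι) (liftMap π ι) (mul_nonneg hr0 hθ0) hDV hDW).mono fun y y' => diagK_mono (fun _ => le_of_eq ?_) y y'
  unfold vWR; ring

end Letters

/-! ## §2 The four (3.42) entries with the full perturbation live, and `EtaRateIneq342` for any family that evaluates to them -/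

section Entries

variable {X X' J ι : Type} [Fintype X] [Fintype X'] [Fintype J] [Fintype ι] [DecidableEq X] [DecidableEq X'] [DecidableEq J] [DecidableEq ι]
  {𝔄 : Type} [NormedRing 𝔄] [NormedAlgebra ℝ 𝔄] [CompleteSpace 𝔄] (e : 𝔄 ≃L[ℝ] (ι → ℝ)) {g : B6.Geometry} (blk : X → g.Site) (π : X' → X)

/-- THE FOUR η-DIFFERENCE ENTRY OPERATORS at a triple `T = (A⁺, A⁻, W_div)` (fine spacing `η′`, coarse `η`, coarse fields = fibrewise means) dressed by a word pair:
`W` (coarse), `W′` (fine) — entries 0∕1 = components of B1a's pair at `vWPert`, entry 2 = B3's source step, entry 3 = B3's derived object.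
[cite: Balaban1985BackgroundPropagators, (3.42) p.397 (the four entries: shape); (3.52) p.400, (3.60) p.402 (shapes)] -/
def vWEntries (η η' : ℝ) (ν : J ⊕ J) (G S D₃ : (X × ι → ℝ) →ₗ[ℝ] (X × ι → ℝ)) (D SD : J ⊕ J → (X × ι → ℝ) →ₗ[ℝ] (X × ι → ℝ))
    (G' S' D₃' : (X' × ι → ℝ) →ₗ[ℝ] (X' × ι → ℝ)) (D' SD' : J ⊕ J → (X' × ι → ℝ) →ₗ[ℝ] (X' × ι → ℝ))
    (T : (J → X' → 𝔄) × (J → X' → 𝔄) × (X' → 𝔄)) (W : (X × ι → ℝ) →ₗ[ℝ] (X × ι → ℝ)) (W' : (X' × ι → ℝ) →ₗ[ℝ] (X' × ι → ℝ)) :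
    Fin 4 → ((X × ι → ℝ) →ₗ[ℝ] (X' × ι → ℝ)) :=
  ![idef (pull (liftMap π ι)) (pull (liftMap π ι)) (projO none ∘ₗ bgPropV (stack G' D') (vWPert (v1coefC e η' T) (v1coefA e η' T) W'))
      (projO none ∘ₗ bgPropV (stack G D) (vWPert (v1coefC e η (v1avg 𝔄 J π T)) (v1coefA e η (v1avg 𝔄 J π T)) W)),
    idef (pull (liftMap π ι)) (pull (liftMap π ι)) (projO (some ν) ∘ₗ bgPropV (stack G' D') (vWPert (v1coefC e η' T) (v1coefA e η' T) W'))
      (projO (some ν) ∘ₗ bgPropV (stack G D) (vWPert (v1coefC e η (v1avg 𝔄 J π T)) (v1coefA e η (v1avg 𝔄 J π T)) W)),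
    idef (pull (liftMap π ι)) (pull (liftMap π ι))
      (projO none ∘ₗ bgSourceV (stack G' D') (stack S' SD') (vWPert (v1coefC e η' T) (v1coefA e η' T) W'))
      (projO none ∘ₗ bgSourceV (stack G D) (stack S SD) (vWPert (v1coefC e η (v1avg 𝔄 J π T)) (v1coefA e η (v1avg 𝔄 J π T)) W)),
    idef (pull (liftMap π ι)) (pull (liftMap π ι)) (bgDerivedV (stack G' D') D₃' (vWPert (v1coefC e η' T) (v1coefA e η' T) W'))
      (bgDerivedV (stack G D) D₃ (vWPert (v1coefC e η (v1avg 𝔄 J π T)) (v1coefA e η (v1avg 𝔄 J π T)) W))]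

/-- THE KERNEL-FAMILY OPS for a carrier whose configurations `U : C` determine a `V′₁` triple `tri U` and the two words `Wc U` (coarse), `Wf U` (fine):
`vWOps4 … n U = vWEntries … (tri U) (Wc U) (Wf U) n`. [cite: Balaban1985BackgroundPropagators, (3.42) p.397 (shape)] -/
def vWOps4 {C : Type} (tri : C → (J → X' → 𝔄) × (J → X' → 𝔄) × (X' → 𝔄)) (Wc : C → ((X × ι → ℝ) →ₗ[ℝ] (X × ι → ℝ)))
    (Wf : C → ((X' × ι → ℝ) →ₗ[ℝ] (X' × ι → ℝ))) (η η' : ℝ) (ν : J ⊕ J) (G S D₃ : (X × ι → ℝ) →ₗ[ℝ] (X × ι → ℝ))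
    (D SD : J ⊕ J → (X × ι → ℝ) →ₗ[ℝ] (X × ι → ℝ)) (G' S' D₃' : (X' × ι → ℝ) →ₗ[ℝ] (X' × ι → ℝ)) (D' SD' : J ⊕ J → (X' × ι → ℝ) →ₗ[ℝ] (X' × ι → ℝ)) :
    Fin 4 → C → ((X × ι → ℝ) →ₗ[ℝ] (X' × ι → ℝ)) :=
  fun n U => vWEntries e π η η' ν G S D₃ D SD G' S' D₃' D' SD' (tri U) (Wc U) (Wf U) n

omit [CompleteSpace 𝔄] in
/-- Unfolding. [folklore] -/
@[simp] theorem vWOps4_apply {C : Type} (tri : C → (J → X' → 𝔄) × (J → X' → 𝔄) × (X' → 𝔄)) (Wc : C → ((X × ι → ℝ) →ₗ[ℝ] (X × ι → ℝ)))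
    (Wf : C → ((X' × ι → ℝ) →ₗ[ℝ] (X' × ι → ℝ))) (η η' : ℝ) (ν : J ⊕ J) (G S D₃ : (X × ι → ℝ) →ₗ[ℝ] (X × ι → ℝ))
    (D SD : J ⊕ J → (X × ι → ℝ) →ₗ[ℝ] (X × ι → ℝ)) (G' S' D₃' : (X' × ι → ℝ) →ₗ[ℝ] (X' × ι → ℝ)) (D' SD' : J ⊕ J → (X' × ι → ℝ) →ₗ[ℝ] (X' × ι → ℝ))
    (n : Fin 4) (U : C) :
    vWOps4 e π tri Wc Wf η η' ν G S D₃ D SD G' S' D₃' D' SD' n U = vWEntries e π η η' ν G S D₃ D SD G' S' D₃' D' SD' (tri U) (Wc U) (Wf U) n := rfl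

variable {G S D₃ : (X × ι → ℝ) →ₗ[ℝ] (X × ι → ℝ)} {D SD : J ⊕ J → (X × ι → ℝ) →ₗ[ℝ] (X × ι → ℝ)} {G' S' D₃' : (X' × ι → ℝ) →ₗ[ℝ] (X' × ι → ℝ)}
  {D' SD' : J ⊕ J → (X' × ι → ℝ) →ₗ[ℝ] (X' × ι → ℝ)}

/-- **THE FOUR ENTRY DEFECTS WITH THE FULL PERTURBATION LIVE, UNDER THE GUARD.**  `U ≡ 1` layer on the product carrier with derived pieces on `J ⊕ J` (majorants
`β·e^{−δd}`, η-defects `m₀·θ·e^{−δd}`, `σ ≤ δ`); spacings `0 ≤ η′ ≤ η ≤ 1`, `η ≤ θ`; guard `c₃₅ > 0`, `a₀ ≥ 0`, `2c₃₅a₀ ≤ 1`, `β·(gVWc35·a₀)·c_r ≤ ½`, `M ≥ 1`, `α₀ > 0`,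
`M·α₀ ≤ a₀`; triple `T` with `(v1Bg 𝔄 J π M θ).Reg335 c₃₅ α₀ T`; words with the species letters at `c_W ≥ 0`.  Then the four `vWEntries` are
`≤ {bgConst, bgConst, bgConst, bgConst1}(β, c_r, m₀, gVWc35, a₀)·θ·e^{−(δ−σ)d}` — ONE application of V0's `hasMaj_entries_of_letters` to `vW_letters_of_reg335`.
[cite: Balaban1985BackgroundPropagators, Thm 3.1 (3.42) p.397 (quantifier template, entries: shapes); (3.35) p.396, (3.52) p.400, (3.60) p.402, (3.63)–(3.65) pp.402–403 (shapes, mechanism)] -/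
theorem hasMaj_vWEntries (htri : Triangle254 g) (hd : ∀ a b : g.Site, 0 ≤ g.dist a b) {σ cr : ℝ} (hσ : 0 ≤ σ) (hcr : 0 ≤ cr) (hrow : RowSum g σ cr)
    {δ β m₀ θ c35 a₀ M α₀ η η' cW : ℝ} (hσδ : σ ≤ δ) (hβ : 0 ≤ β) (hm₀ : 0 ≤ m₀) (hθ : 0 ≤ θ) (hc35 : 0 < c35) (ha₀ : 0 ≤ a₀) (ha₀1 : 2 * (c35 * a₀) ≤ 1)
    (hq : β * (gVWc35 J (basisConst e) c35 cW * a₀) * cr ≤ 1 / 2) (hM : 1 ≤ M) (hα₀ : 0 < α₀) (hMα : M * α₀ ≤ a₀)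
    (hη' : 0 ≤ η') (hη'η : η' ≤ η) (hη1 : η ≤ 1) (hηθ : η ≤ θ) (hcW : 0 ≤ cW) {ν : J ⊕ J}
    (hG : HasMaj (BlockNorm.ofBlocks g (liftBlk blk ι)) (BlockNorm.ofBlocks g (liftBlk blk ι)) G (fun y y' => β * Real.exp (-(δ * g.dist y y'))))
    (hD : ∀ μ, HasMaj (BlockNorm.ofBlocks g (liftBlk blk ι)) (BlockNorm.ofBlocks g (liftBlk blk ι)) (D μ) (fun y y' => β * Real.exp (-(δ * g.dist y y'))))
    (hG' : HasMaj (BlockNorm.ofBlocks g (liftBlk (blk ∘ π) ι)) (BlockNorm.ofBlocks g (liftBlk (blk ∘ π) ι)) G' (fun y y' => β * Real.exp (-(δ * g.dist y y'))))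
    (hD' : ∀ μ, HasMaj (BlockNorm.ofBlocks g (liftBlk (blk ∘ π) ι)) (BlockNorm.ofBlocks g (liftBlk (blk ∘ π) ι)) (D' μ) (fun y y' => β * Real.exp (-(δ * g.dist y y'))))
    (hS : HasMaj (BlockNorm.ofBlocks g (liftBlk blk ι)) (BlockNorm.ofBlocks g (liftBlk blk ι)) S (fun y y' => β * Real.exp (-(δ * g.dist y y'))))
    (hSD : ∀ μ, HasMaj (BlockNorm.ofBlocks g (liftBlk blk ι)) (BlockNorm.ofBlocks g (liftBlk blk ι)) (SD μ) (fun y y' => β * Real.exp (-(δ * g.dist y y'))))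
    (hD₃' : HasMaj (BlockNorm.ofBlocks g (liftBlk (blk ∘ π) ι)) (BlockNorm.ofBlocks g (liftBlk (blk ∘ π) ι)) D₃' (fun y y' => β * Real.exp (-(δ * g.dist y y'))))
    (hDG : HasMaj (BlockNorm.ofBlocks g (liftBlk blk ι)) (BlockNorm.ofBlocks g (liftBlk (blk ∘ π) ι))
      (idef (pull (liftMap π ι)) (pull (liftMap π ι)) G' G) (fun y y' => m₀ * θ * Real.exp (-(δ * g.dist y y'))))
    (hDD : ∀ μ, HasMaj (BlockNorm.ofBlocks g (liftBlk blk ι)) (BlockNorm.ofBlocks g (liftBlk (blk ∘ π) ι))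
      (idef (pull (liftMap π ι)) (pull (liftMap π ι)) (D' μ) (D μ)) (fun y y' => m₀ * θ * Real.exp (-(δ * g.dist y y'))))
    (hDS : HasMaj (BlockNorm.ofBlocks g (liftBlk blk ι)) (BlockNorm.ofBlocks g (liftBlk (blk ∘ π) ι))
      (idef (pull (liftMap π ι)) (pull (liftMap π ι)) S' S) (fun y y' => m₀ * θ * Real.exp (-(δ * g.dist y y'))))
    (hDSD : ∀ μ, HasMaj (BlockNorm.ofBlocks g (liftBlk blk ι)) (BlockNorm.ofBlocks g (liftBlk (blk ∘ π) ι))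
      (idef (pull (liftMap π ι)) (pull (liftMap π ι)) (SD' μ) (SD μ)) (fun y y' => m₀ * θ * Real.exp (-(δ * g.dist y y'))))
    (hDD₃ : HasMaj (BlockNorm.ofBlocks g (liftBlk blk ι)) (BlockNorm.ofBlocks g (liftBlk (blk ∘ π) ι))
      (idef (pull (liftMap π ι)) (pull (liftMap π ι)) D₃' D₃) (fun y y' => m₀ * θ * Real.exp (-(δ * g.dist y y'))))
    {T : (J → X' → 𝔄) × (J → X' → 𝔄) × (X' → 𝔄)} (hreg : (v1Bg 𝔄 J π M θ).Reg335 c35 α₀ T)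
    {W : (X × ι → ℝ) →ₗ[ℝ] (X × ι → ℝ)} {W' : (X' × ι → ℝ) →ₗ[ℝ] (X' × ι → ℝ)}
    (hW : HasMaj (BlockNorm.ofBlocks g (liftBlk blk ι)) (BlockNorm.ofBlocks g (liftBlk blk ι)) W (diagK fun _ => cW * (c35 * M * α₀)))
    (hW' : HasMaj (BlockNorm.ofBlocks g (liftBlk (blk ∘ π) ι)) (BlockNorm.ofBlocks g (liftBlk (blk ∘ π) ι)) W' (diagK fun _ => cW * (c35 * M * α₀)))
    (hDW : HasMaj (BlockNorm.ofBlocks g (liftBlk blk ι)) (BlockNorm.ofBlocks g (liftBlk (blk ∘ π) ι))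
      (idef (pull (liftMap π ι)) (pull (liftMap π ι)) W' W) (diagK fun _ => cW * (c35 * M * α₀) * θ)) :
    ∀ n : Fin 4, HasMaj (BlockNorm.ofBlocks g (liftBlk blk ι)) (BlockNorm.ofBlocks g (liftBlk (blk ∘ π) ι))
      (vWEntries e π η η' ν G S D₃ D SD G' S' D₃' D' SD' T W W' n)
      (fun y y' => (if n = 3 then bgConst1 β cr m₀ (gVWc35 J (basisConst e) c35 cW) a₀ else bgConst β cr m₀ (gVWc35 J (basisConst e) c35 cW) a₀) * θ *
        Real.exp (-((δ - σ) * g.dist y y'))) := by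
  obtain ⟨hR0, hRa, hV, hV', hDV⟩ :=
    vW_letters_of_reg335 e (g := g) blk π hη' hη'η hη1 hηθ hc35 hM hα₀ hMα ha₀1 hcW hreg hW hW' hDW
  have hK : 0 ≤ gVWc35 J (basisConst e) c35 cW := (le_gVWc35 (J := J) (basisConst_nonneg e) hc35 hcW).2.1.le
  obtain ⟨h01, h2, h3⟩ := hasMaj_entries_of_letters (liftBlk blk ι) (liftMap π ι) htri hd hσ hcr hrow hσδ hβ hm₀ hθ hK ha₀ hq hR0 hRa hG hD hG' hD'
    hS hSD hD₃' hDG hDD hDS hDSD hDD₃ hV hV' hDV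
  intro n
  fin_cases n
  · exact h01 none
  · exact h01 (some ν)
  · exact h2
  · exact h3

/-- **`EtaRateIneq342` WITH THE FULL PERTURBATION LIVE, FOR ANY FAMILY THAT EVALUATES TO THE ENTRIES.**  Same data as `hasMaj_vWEntries` plus `η = g.eta > 0`, `L > 0`,
sites of size `≥ 1`, `θ ≤ rateWeight γ`; ANY carrier `B` and kernel ops `T4 : Fin 4 → B.Cfg → …` with `T4 n U = vWEntries … n` at the configuration `U`.  Then
`EtaRateIneq342 (opFamily … T4) (bgConst + bgConst1) (δ − σ) γ U` (constants at `gVWc35`). [cite: Balaban1985BackgroundPropagators, Thm 3.1 (3.42) p.397 (shape, quantifier template)] -/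
theorem etaRateIneq342_vWEntries {B : B9.Backgrounds} (T4 : Fin 4 → B.Cfg → ((X × ι → ℝ) →ₗ[ℝ] (X' × ι → ℝ))) (U : B.Cfg)
    {T : (J → X' → 𝔄) × (J → X' → 𝔄) × (X' → 𝔄)} {W : (X × ι → ℝ) →ₗ[ℝ] (X × ι → ℝ)} {W' : (X' × ι → ℝ) →ₗ[ℝ] (X' × ι → ℝ)} {ν : J ⊕ J} {η' : ℝ}
    (hT4 : ∀ n, T4 n U = vWEntries e π g.eta η' ν G S D₃ D SD G' S' D₃' D' SD' T W W' n)
    (htri : Triangle254 g) (hd : ∀ a b : g.Site, 0 ≤ g.dist a b) {σ cr : ℝ} (hσ : 0 ≤ σ) (hcr : 0 ≤ cr) (hrow : RowSum g σ cr)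
    (hη : 0 < g.eta) (hL : 0 < g.L) (hlen : ∀ y, 1 ≤ g.len y) {δ β m₀ θ c35 a₀ M α₀ γ cW : ℝ}
    (hσδ : σ ≤ δ) (hβ : 0 ≤ β) (hm₀ : 0 ≤ m₀) (hθ : 0 ≤ θ) (hθγ : ∀ y, θ ≤ rateWeight g γ y) (hc35 : 0 < c35) (ha₀ : 0 ≤ a₀)
    (ha₀1 : 2 * (c35 * a₀) ≤ 1) (hq : β * (gVWc35 J (basisConst e) c35 cW * a₀) * cr ≤ 1 / 2) (hM : 1 ≤ M) (hα₀ : 0 < α₀) (hMα : M * α₀ ≤ a₀)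
    (hη' : 0 ≤ η') (hη'η : η' ≤ g.eta) (hη1 : g.eta ≤ 1) (hηθ : g.eta ≤ θ) (hcW : 0 ≤ cW)
    (hG : HasMaj (BlockNorm.ofBlocks g (liftBlk blk ι)) (BlockNorm.ofBlocks g (liftBlk blk ι)) G (fun y y' => β * Real.exp (-(δ * g.dist y y'))))
    (hD : ∀ μ, HasMaj (BlockNorm.ofBlocks g (liftBlk blk ι)) (BlockNorm.ofBlocks g (liftBlk blk ι)) (D μ) (fun y y' => β * Real.exp (-(δ * g.dist y y'))))
    (hG' : HasMaj (BlockNorm.ofBlocks g (liftBlk (blk ∘ π) ι)) (BlockNorm.ofBlocks g (liftBlk (blk ∘ π) ι)) G' (fun y y' => β * Real.exp (-(δ * g.dist y y'))))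
    (hD' : ∀ μ, HasMaj (BlockNorm.ofBlocks g (liftBlk (blk ∘ π) ι)) (BlockNorm.ofBlocks g (liftBlk (blk ∘ π) ι)) (D' μ) (fun y y' => β * Real.exp (-(δ * g.dist y y'))))
    (hS : HasMaj (BlockNorm.ofBlocks g (liftBlk blk ι)) (BlockNorm.ofBlocks g (liftBlk blk ι)) S (fun y y' => β * Real.exp (-(δ * g.dist y y'))))
    (hSD : ∀ μ, HasMaj (BlockNorm.ofBlocks g (liftBlk blk ι)) (BlockNorm.ofBlocks g (liftBlk blk ι)) (SD μ) (fun y y' => β * Real.exp (-(δ * g.dist y y'))))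
    (hD₃' : HasMaj (BlockNorm.ofBlocks g (liftBlk (blk ∘ π) ι)) (BlockNorm.ofBlocks g (liftBlk (blk ∘ π) ι)) D₃' (fun y y' => β * Real.exp (-(δ * g.dist y y'))))
    (hDG : HasMaj (BlockNorm.ofBlocks g (liftBlk blk ι)) (BlockNorm.ofBlocks g (liftBlk (blk ∘ π) ι))
      (idef (pull (liftMap π ι)) (pull (liftMap π ι)) G' G) (fun y y' => m₀ * θ * Real.exp (-(δ * g.dist y y'))))
    (hDD : ∀ μ, HasMaj (BlockNorm.ofBlocks g (liftBlk blk ι)) (BlockNorm.ofBlocks g (liftBlk (blk ∘ π) ι))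
      (idef (pull (liftMap π ι)) (pull (liftMap π ι)) (D' μ) (D μ)) (fun y y' => m₀ * θ * Real.exp (-(δ * g.dist y y'))))
    (hDS : HasMaj (BlockNorm.ofBlocks g (liftBlk blk ι)) (BlockNorm.ofBlocks g (liftBlk (blk ∘ π) ι))
      (idef (pull (liftMap π ι)) (pull (liftMap π ι)) S' S) (fun y y' => m₀ * θ * Real.exp (-(δ * g.dist y y'))))
    (hDSD : ∀ μ, HasMaj (BlockNorm.ofBlocks g (liftBlk blk ι)) (BlockNorm.ofBlocks g (liftBlk (blk ∘ π) ι))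
      (idef (pull (liftMap π ι)) (pull (liftMap π ι)) (SD' μ) (SD μ)) (fun y y' => m₀ * θ * Real.exp (-(δ * g.dist y y'))))
    (hDD₃ : HasMaj (BlockNorm.ofBlocks g (liftBlk blk ι)) (BlockNorm.ofBlocks g (liftBlk (blk ∘ π) ι))
      (idef (pull (liftMap π ι)) (pull (liftMap π ι)) D₃' D₃) (fun y y' => m₀ * θ * Real.exp (-(δ * g.dist y y'))))
    (hreg : (v1Bg 𝔄 J π M θ).Reg335 c35 α₀ T)
    (hW : HasMaj (BlockNorm.ofBlocks g (liftBlk blk ι)) (BlockNorm.ofBlocks g (liftBlk blk ι)) W (diagK fun _ => cW * (c35 * M * α₀)))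
    (hW' : HasMaj (BlockNorm.ofBlocks g (liftBlk (blk ∘ π) ι)) (BlockNorm.ofBlocks g (liftBlk (blk ∘ π) ι)) W' (diagK fun _ => cW * (c35 * M * α₀)))
    (hDW : HasMaj (BlockNorm.ofBlocks g (liftBlk blk ι)) (BlockNorm.ofBlocks g (liftBlk (blk ∘ π) ι))
      (idef (pull (liftMap π ι)) (pull (liftMap π ι)) W' W) (diagK fun _ => cW * (c35 * M * α₀) * θ)) :
    EtaRateIneq342 (opFamily (g := g) (B := B) (liftBlk blk ι) (liftBlk (blk ∘ π) ι) T4)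
      (bgConst β cr m₀ (gVWc35 J (basisConst e) c35 cW) a₀ + bgConst1 β cr m₀ (gVWc35 J (basisConst e) c35 cW) a₀) (δ - σ) γ U := by
  have key := hasMaj_vWEntries e blk π htri hd hσ hcr hrow hσδ hβ hm₀ hθ hc35 ha₀ ha₀1 hq hM hα₀ hMα hη' hη'η hη1 hηθ hcW (ν := ν) hG hD hG' hD' hS
    hSD hD₃' hDG hDD hDS hDSD hDD₃ hreg hW hW' hDW
  have hgc : 0 ≤ gVWc35 J (basisConst e) c35 cW := (le_gVWc35 (J := J) (basisConst_nonneg e) hc35 hcW).2.1.le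
  have hC0 : 0 ≤ bgConst β cr m₀ (gVWc35 J (basisConst e) c35 cW) a₀ := bgConst_nonneg hβ hcr hm₀ hgc ha₀
  have hC1 : 0 ≤ bgConst1 β cr m₀ (gVWc35 J (basisConst e) c35 cW) a₀ := bgConst1_nonneg hβ hcr hm₀ hgc ha₀
  refine etaRateIneq342_of_hasMaj (g := g) (B := B) (liftBlk blk ι) (liftBlk (blk ∘ π) ι) hη.le hL.le (add_nonneg hC0 hC1) T4 U fun n => ?_
  rw [hT4 n]
  refine (key n).mono fun y y' => ?_
  by_cases hn : n = 3
  · simp only [hn, if_true]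
    exact entryMajorant_le_etaRateShape (X := X × ι) (liftBlk blk ι) hη hL hlen (δ₀ := δ - σ) hθ hθγ hC1 (le_add_of_nonneg_left hC0) 3 y y'
  · simp only [hn, if_false]
    exact entryMajorant_le_etaRateShape (X := X × ι) (liftBlk blk ι) hη hL hlen (δ₀ := δ - σ) hθ hθγ hC0 (le_add_of_nonneg_right hC1) n y y'

end Entries

end Summit.QuantumFields.YangMills.BalabanUVNodes.N15.BackgroundLayer

end
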